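import Summits.AtomisticToContinuum.Crystallization.Theses.NashClassCertificates

/-!
# Ground states are Nash (route `NashClassCertificates`, support item `stmt-AtomisticToContinuum-16830`,
decl `GroundStatesAreNash`; stub S3 `stub_groundStatesAreNash` of crux `HullMinimality.LayeredWindows`,
stmt-AtomisticToContinuum-11778, line `registered`)

STATEMENT. For every Lennard-Jones ground state `x` of `N` particles in `ℝ³`, every particle `i` and every
point `y` distinct from the other particles, `siteEnergy(x, i) = ∑_{j ≠ i} V_LJ(|xᵢ − xⱼ|) ≤ ∑_{j ≠ i} V_LJ(|y − xⱼ|)`: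
no single particle lowers the energy by relocating to a free point (a ground state is a pure Nash equilibrium of
the site-selection game whose exact potential is the energy).

PROOF (one-particle move, Blanc–Lewin 2015 §2.2). The relocated configuration `update x i y` consists of distinct
points (`y` avoids the other particles and `x` is injective), so its energy is `≥ E(N) = 𝓔(x)`
(`groundStateEnergy_lennardJones_le`, the infimum defining `E(N)` being a genuine one because `V_LJ ≥ −1/12`).
By double counting `2𝓔 = ∑ᵢ 𝓔ⁱ` (`two_mul_interactionEnergy`) and the update identity
`∑ₐ 𝓔ᵃ(update x i y) − ∑ₐ 𝓔ᵃ(x) = 2(∑_{k ≠ i} V(|y − x_k|) − 𝓔ⁱ(x))` (`sum_siteEnergy_update_sub`), the energy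
change is exactly `∑_{k ≠ i} V(|y − x_k|) − 𝓔ⁱ(x) ≥ 0`.
-/

noncomputable section

open scoped BigOperators Classical

namespace Summit.AtomisticToContinuum.Crystallization.Theorems.LayeredWindowsLocal

open Literature.MathematicalPhysics.StatisticalMechanics

/-- Relocating particle `i` of a configuration `x` of distinct points to a point `y` distinct from the other
particles yields a configuration of distinct points. -/
theorem update_injective_of_forall_ne {N d : ℕ} {x : Fin N → EuclideanSpace ℝ (Fin d)}
    (hx : Function.Injective x) {i : Fin N} {y : EuclideanSpace ℝ (Fin d)}
    (hy : ∀ j : Fin N, j ≠ i → y ≠ x j) : Function.Injective (Function.update x i y) := by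
  intro a b hab
  by_cases ha : a = i <;> by_cases hb : b = i
  · exact ha.trans hb.symm
  · subst ha
    rw [Function.update_self, Function.update_of_ne hb] at hab
    exact absurd hab (hy b hb)
  · subst hb
    rw [Function.update_self, Function.update_of_ne ha] at hab
    exact absurd hab.symm (hy a ha)
  · rw [Function.update_of_ne ha, Function.update_of_ne hb] at hab
    exact hx hab

/-- **One-particle move.** In a Lennard-Jones ground state `x`, relocating particle `i` to a point `y` distinct
from the other particles does not lower the energy: `𝓔ⁱ(x) ≤ ∑_{k ≠ i} V_LJ(|y − x_k|)` (the relocated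
configuration is an injective competitor, so its energy is `≥ E(N) = 𝓔(x)`; `two_mul_interactionEnergy` and
`sum_siteEnergy_update_sub` identify the energy change with the change of the site energy of `i`). -/
theorem siteEnergy_le_sum_of_isGroundState {N d : ℕ} {x : Fin N → EuclideanSpace ℝ (Fin d)}
    (hx : IsGroundState lennardJones x) (i : Fin N) {y : EuclideanSpace ℝ (Fin d)}
    (hy : ∀ j : Fin N, j ≠ i → y ≠ x j) :
    siteEnergy lennardJones x i ≤ ∑ j ∈ Finset.univ.erase i, lennardJones (dist y (x j)) := by
  have hle : interactionEnergy lennardJones x ≤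
      interactionEnergy lennardJones (Function.update x i y) := by
    rw [hx.2]
    exact groundStateEnergy_lennardJones_le (update_injective_of_forall_ne hx.1 hy)
  have hdiff := sum_siteEnergy_update_sub lennardJones x i y
  have h2 := two_mul_interactionEnergy lennardJones x
  have h2' := two_mul_interactionEnergy lennardJones (Function.update x i y)
  linarith

/-- **Stub S3 `stub_groundStatesAreNash` = item stmt-AtomisticToContinuum-16830 BY NAME: ground states are Nash.**
For every Lennard-Jones ground state `x` of `N` particles in `ℝ³`, every `i` and every point `y` distinct from the
other particles, `siteEnergy(x, i) ≤ ∑_{j ≠ i} V_LJ(|y − x_j|)` (one-particle move,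
`siteEnergy_le_sum_of_isGroundState` at `d = 3`). -/
theorem stub_groundStatesAreNash :
    Summit.AtomisticToContinuum.Crystallization.Theses.NashClassCertificates.GroundStatesAreNash := by
  unfold Summit.AtomisticToContinuum.Crystallization.Theses.NashClassCertificates.GroundStatesAreNash
  intro N x hx i y hy
  exact siteEnergy_le_sum_of_isGroundState hx i hy

end Summit.AtomisticToContinuum.Crystallization.Theorems.LayeredWindowsLocal

end
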